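import Mathlib
import Literature.AlgebraicGeometry.Resolution.Blowups
import Literature.AlgebraicGeometry.Resolution.BlowupsProduct
import Literature.AlgebraicGeometry.Resolution.MarkedIdealsLemmas

/-!
# A blow-up along `𝓘` is a blow-up along `𝓘ⁿ` (`n ≥ 1`), and conversely

(crux stmt-ResolutionOfSingularities-15640 `WildQuotients.WildQuotientResolution`, line `Sketch`,
sector `|G| = p`; next rung R-T J₅ of `L/w45c/CHAIN.md` v8 — generic glue for the ONE-SHOT design
of the `μ₄` vertex piece (stub-4 RESULT 2026-08-27T11:2xZ, option α): the first centre of the rung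
is the colon ideal sheaf `𝓙 = (𝓘_T³ : 𝓘_{C_a})`, which off the vertex curve `C_a` is the CUBE
`𝓘_T³` of the reduced singular-locus ideal; the bricks on the pieces avoiding `C_a` are blow-ups of
the reduced `𝓘_T` (stub-2's T3, card H), and this file says they are equally blow-ups of `𝓘_T³`.
[OURS · L1 W4.5c] — NOT a statement of any manuscript; replaces the role of no printed item.
Prover res-L1-w45c-stub-4 (gen 4).)

* `isBlowup_pow` — `IsBlowup π 𝓘 → IsBlowup π (𝓘 ^ n)` for `n ≠ 0`;
* `isBlowup_of_pow` — `IsBlowup π (𝓘 ^ n) → IsBlowup π 𝓘` for `n ≠ 0`;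
* `isBlowup_pow_iff`.

Proof: the universal property (GW Def. 13.90) only sees which morphisms pull the centre back to an
effective Cartier divisor, and `(f⁻¹𝓘)ⁿ = f⁻¹(𝓘ⁿ)` (`comap_pow`) is an effective Cartier divisor
iff `f⁻¹𝓘` is (`IsEffectiveCartier.pow`, `IsEffectiveCartier.of_mul_left`, Stacks 07ZV).
-/

-- single-problem summit: the doubled namespace component `ResolutionOfSingularities` is forced
set_option linter.dupNamespace false

noncomputable section

open CategoryTheory AlgebraicGeometry
open Literature.AlgebraicGeometry.Resolution

namespace Summit.ResolutionOfSingularities.ResolutionOfSingularities.Theorems.WildQuotientResolution.BlowupExit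

universe u

variable {X' X : Scheme.{u}} {π : X' ⟶ X} {I : X.IdealSheafData}

/-- `f⁻¹(𝓘ⁿ)` is an effective Cartier divisor iff `f⁻¹𝓘` is, for `n ≠ 0`.
[cite: StacksProject, Tag 07ZV] -/
theorem isEffectiveCartier_comap_pow_iff {W : Scheme.{u}} (f : W ⟶ X) {n : ℕ} (hn : n ≠ 0) :
    IsEffectiveCartier ((I ^ n).comap f) ↔ IsEffectiveCartier (I.comap f) := by
  rw [comap_pow]
  refine ⟨fun h => ?_, fun h => h.pow n⟩
  obtain ⟨m, rfl⟩ := Nat.exists_eq_succ_of_ne_zero hn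
  rw [pow_succ'] at h
  exact h.of_mul_left

/-- **A blow-up along `𝓘` is a blow-up along `𝓘ⁿ`** (`n ≠ 0`). [folklore] -/
theorem isBlowup_pow (h : IsBlowup π I) {n : ℕ} (hn : n ≠ 0) : IsBlowup π (I ^ n) := by
  refine ⟨(isEffectiveCartier_comap_pow_iff π hn).mpr h.isEffectiveCartier, fun W f hf => ?_⟩
  exact h.universal f ((isEffectiveCartier_comap_pow_iff f hn).mp hf)

/-- **A blow-up along `𝓘ⁿ` is a blow-up along `𝓘`** (`n ≠ 0`). [folklore] -/
theorem isBlowup_of_pow {n : ℕ} (h : IsBlowup π (I ^ n)) (hn : n ≠ 0) : IsBlowup π I := by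
  refine ⟨(isEffectiveCartier_comap_pow_iff π hn).mp h.isEffectiveCartier, fun W f hf => ?_⟩
  exact h.universal f ((isEffectiveCartier_comap_pow_iff f hn).mpr hf)

/-- `IsBlowup π (𝓘ⁿ) ↔ IsBlowup π 𝓘` for `n ≠ 0`. [folklore] -/
theorem isBlowup_pow_iff {n : ℕ} (hn : n ≠ 0) : IsBlowup π (I ^ n) ↔ IsBlowup π I :=
  ⟨fun h => isBlowup_of_pow h hn, fun h => isBlowup_pow h hn⟩

end Summit.ResolutionOfSingularities.ResolutionOfSingularities.Theorems.WildQuotientResolution.BlowupExit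

end
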